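import Literature.MathematicalPhysics.QuantumFieldTheory.Balaban1983to89.Beta.RemainderLocalitySockets
import Literature.MathematicalPhysics.QuantumFieldTheory.Balaban1983to89.B11SectG

/-!
# [Balaban1987RG1] (5.10) p. 293 ∕ (1.21) p. 264 shape for COMPOSITE operators: a torus operator family whose members act,
# entrywise, as the periodisation of one block-periodic ℤ^d kernel is closed under the operator algebra — so the
# (182)-composite δ𝐇∕δB = (𝔄₀ + H₀) − H𝔇(𝔄₀ + H₀) of periodised pieces is periodised, and NODE E's letter `hker` holds
# for every window (`Beta.RemainderKernelPeriodised`)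

statement-level skeleton of published theorems with citation tags; proofs where landed; nothing here is a claim
about the Yang–Mills mass gap.

HONEST FRAMING (cell rule).  Bookkeeping for the k-uniform remainder chain of row (D4) (`RemainderConst` ⇐ ONE
`ChainTFac190` instance, `Beta.RemainderDecay190`); discharges NOTHING of `BetaPertH`; NOT B12 Thm 2, NOT the continuum
limit, NOT Clay.  Unit `b2b-balaban-beta-an4` gen 95 (BINDER row D4 OWNER; cell pub-balaban).  Imports
`Beta.RemainderLocalitySockets` (this lineage gen 11, carrying gen 9's `Beta.EntrywiseVolumeLimit`: `Kernel₂`, `IsPeriodic₂`,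
`RowBound`, `compKer`, `periodise₂`, the product rule `periodise₂_compKer`; and the torus sites `TPt`, `proj`) and
`B11SectG` (lit-balaban: the (182) identity `Eq182`) ONLY; nothing edited.

WHAT.  NODE E of row (D4) on the (4.4)-space model consumes, per window Y, the (5.10)-type letter `hker`: *the window
entries of the kernel of (δ𝐇∕δB)_n between a source site and the window sites are the entries of the periodisation of a
decaying block-periodic ℤ^d kernel* (`RemainderDecay190SupNormLimit.hconv_restrictCLM_of_periodised`, generation 94;
`RemainderDecay190SupNormLeaves.nonempty_polLeavesTFac190H_supNorm`, generation 95).  [15] (182) p. 307 writes δ𝐇∕δB as a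
COMPOSITE of Sect. G operators, `dH = (𝔄₀ + H₀) − H ∘ 𝔇 ∘ (𝔄₀ + H₀)` (tree: `B11SectG.Eq182`).  THIS FILE shows that the
letter propagates through such composites:
* §1 `apply_eq_sum_single` (a linear map on the torus fields is its matrix), the ENTRY SHAPE
  `A (δ_b) a = K̂(a, b)` (`K̂ = periodise₂ s K`) and its closure under `+` (`entry_add`), scalars (`entry_smul`),
  `−` (`entry_sub`) and COMPOSITION (`entry_comp`: `(A ∘ B)(δ_b) a = (K₁ ∘ K₂)^(a, b)` — the product rule
  `periodise₂_compKer`, [Balaban1984PropagatorsI] p. 36 *"relating G on the torus to G on the whole lattice in the usual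
  way"*), with the block-periodicity ∕ row-bound bookkeeping of the composite kernels (`isPeriodic₂_compKer` — reindexing by
  the period translation; private helpers for sums, scalars and the submultiplicativity of row bounds under `compKer`).
* §2 **`entry_eq182`** — if `𝔄₀`, `H₀`, `H`, `𝔇` on the torus with `s` sites per direction act entrywise as the
  periodisations of block-periodic row-bounded ℤ^d kernels `a₀`, `h₀`, `h`, `𝔡`, and `dH` satisfies (182), then `dH`
  acts entrywise as the periodisation of the ℤ^d kernel `k₁₈₂ := (a₀ + h₀) − h ∘ 𝔡 ∘ (a₀ + h₀)` (written with
  `compKer`), which is block-periodic with a row bound — ONE kernel for all volumes once the pieces are.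
* §3 **`hker_of_entry`** — the entry shape for a family `dH n` over the tori `N n·M` and ONE kernel `S` IS NODE E's
  letter `hker` for every window `Y` and window sites `e Y` (with `S Y := S`): the hypothesis of generation 94 ∕ 95's
  NODE E theorems, verbatim.
So for model operator families assembled from periodised pieces by the Sect. G algebra, `hker` and the joint
periodicity `hS` are THEOREMS; the decay `hdec` of the composite kernel is the one remaining analytic input (row
bounds are carried here; the exponential rate of a composite is `Beta.VolumeConvolution`'s business and is not
re-derived).  WHAT IS *NOT* DONE: no operator of Bałaban's is constructed; that HIS 𝔄₀, H₀, H, 𝔇 at zero background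
are periodisations of ℤ^d kernels is NODE O's statement, not proved here; row D4 class UNCHANGED (instance 0∕1;
critical-path width 0 = NODE O; D4 DISCHARGE NO DATE).  No `def`, no named fact, no `sorry`, standard axioms; 7 public + 6 private theorems.
HONEST DEPENDENCY: continuum YM on T⁴ ⇐ BetaPertH ∧ nine spine estimates (0/9 proved); BetaPertH ⇐ (D1) ∧ (D4) ∧
CAP+tail; G-an2-4 gates asym, D1 and NE2/3/4.

Sources: [I] = T. Bałaban, Commun. Math. Phys. **109** (1987) 249–301 [Balaban1987RG1], (1.21) p. 264, (5.10) p. 293;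
[15] = T. Bałaban, Commun. Math. Phys. **102** (1985) 277–309 [Balaban1985Variational], (182) p. 307; T. Bałaban, Commun.
Math. Phys. **95** (1984) 17–40 [Balaban1984PropagatorsI], p. 36; G. Slade, Commun. Math. Phys. **358** (2018)
[Slade2017], Lemma 2.2.2 (the product rule, proved in `Beta.EntrywiseVolumeLimit`).
-/

namespace Literature.MathematicalPhysics.QuantumFieldTheory.Balaban1983to89.Beta.RemainderKernelPeriodised

open Literature.MathematicalPhysics.QuantumFieldTheory.Balaban1983to89
open Literature.MathematicalPhysics.QuantumFieldTheory.Balaban1983to89.Beta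
  (Kernel₂ IsPeriodic₂ RowBound compKer periodise₂ periodise₂_add periodise₂_const_mul periodise₂_compKer
    imageShift imageShiftEquiv imageShiftEquiv_apply)
open Literature.MathematicalPhysics.QuantumFieldTheory.Balaban1983to89.TreeLengthTorus (TPt proj)
open Literature.MathematicalPhysics.QuantumFieldTheory.Balaban1983to89.B13ScaleTransfer (Pt)
open Literature.MathematicalPhysics.QuantumFieldTheory.Balaban1983to89.B11SectG (Eq182)

variable {d : ℕ}

/-! ## 1. The entry shape `A (δ_b) a = K̂(a, b)` and its closure under the operator algebra -/

section Kernels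

variable {s : ℕ} {K T S : Kernel₂ d} {B B₁ B₂ c : ℝ}

/-- Block-periodicity is preserved by sums. [folklore] -/
private theorem isPeriodic₂_add (hT : IsPeriodic₂ s T) (hS : IsPeriodic₂ s S) : IsPeriodic₂ s (T + S) := fun x y n => by
  simp only [Pi.add_apply, hT x y n, hS x y n]

/-- Block-periodicity is preserved by scalars. [folklore] -/
private theorem isPeriodic₂_smul (hT : IsPeriodic₂ s T) (c : ℝ) : IsPeriodic₂ s (fun x y => c * T x y) := fun x y n => by
  show c * T (imageShift s x n) (imageShift s y n) = c * T x y
  rw [hT x y n]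

/-- **Block-periodicity is preserved by composition** (reindex the summation variable by the period translation).
[cite: Slade2017, Lemma 2.2.2 (proof, first sentence)] -/
theorem isPeriodic₂_compKer (hT : IsPeriodic₂ s T) (hS : IsPeriodic₂ s S) : IsPeriodic₂ s (compKer T S) := by
  intro x y n
  show (∑' z, T (imageShift s x n) z * S z (imageShift s y n)) = ∑' z, T x z * S z y
  rw [← (imageShiftEquiv s n).tsum_eq]
  exact tsum_congr fun z => by rw [imageShiftEquiv_apply, hT x z n, hS z y n]

/-- Row bounds add. [folklore] -/
private theorem rowBound_add (hT : RowBound T B₁) (hS : RowBound S B₂) : RowBound (T + S) (B₁ + B₂) := fun x => by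
  have h1 := (hT x).1
  have h2 := (hS x).1
  have h3 : Summable fun y => |(T + S) x y| :=
    Summable.of_nonneg_of_le (fun _ => abs_nonneg _) (fun y => abs_add_le _ _) (h1.add h2)
  refine ⟨h3, ?_⟩
  calc ∑' y, |(T + S) x y| ≤ ∑' y, (|T x y| + |S x y|) :=
        h3.tsum_le_tsum (fun y => abs_add_le _ _) (h1.add h2)
    _ = ∑' y, |T x y| + ∑' y, |S x y| := h1.tsum_add h2
    _ ≤ B₁ + B₂ := add_le_add (hT x).2 (hS x).2

/-- Row bounds scale. [folklore] -/
private theorem rowBound_smul (hT : RowBound T B) (c : ℝ) : RowBound (fun x y => c * T x y) (|c| * B) := fun x => by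
  have h1 : (fun y => |c * T x y|) = fun y => |c| * |T x y| := funext fun y => abs_mul _ _
  rw [h1]
  exact ⟨(hT x).1.mul_left _, by rw [tsum_mul_left]; exact mul_le_mul_of_nonneg_left (hT x).2 (abs_nonneg c)⟩

/-- **Row bounds multiply under composition**: `Σ_y |Σ_z T(x,z)S(z,y)| ≤ Σ_z |T(x,z)| Σ_y |S(z,y)| ≤ B₁B₂` (Fubini for
the non-negative double family). [folklore] -/
private theorem rowBound_compKer (hT : RowBound T B₁) (hS : RowBound S B₂) : RowBound (compKer T S) (B₁ * B₂) := by
  intro x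
  have hB₂ : 0 ≤ B₂ := hS.nonneg
  have hTx : Summable fun z => |T x z| := (hT x).1
  have hSz : ∀ z, Summable fun y => |S z y| := fun z => (hS z).1
  -- the non-negative double family `(z, y) ↦ |T x z| |S z y|` is summable
  have hnn : 0 ≤ fun p : (Fin d → ℤ) × (Fin d → ℤ) => |T x p.1| * |S p.1 p.2| :=
    fun p => mul_nonneg (abs_nonneg _) (abs_nonneg _)
  have hrow : ∀ z, (∑' y, |T x z| * |S z y|) ≤ |T x z| * B₂ := fun z => by
    rw [tsum_mul_left]
    exact mul_le_mul_of_nonneg_left (hS z).2 (abs_nonneg _)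
  have h2 : Summable fun p : (Fin d → ℤ) × (Fin d → ℤ) => |T x p.1| * |S p.1 p.2| := by
    refine (summable_prod_of_nonneg hnn).mpr ⟨fun z => (hSz z).mul_left (|T x z|), ?_⟩
    exact Summable.of_nonneg_of_le (fun z => tsum_nonneg fun y => hnn (z, y)) hrow (hTx.mul_right B₂)
  have hterm : ∀ y, Summable fun z => |T x z| * |S z y| := fun y => h2.prod_symm.prod_factor y
  have hdom : ∀ y, |compKer T S x y| ≤ ∑' z, |T x z| * |S z y| := fun y => by
    have h4 : Summable fun z => T x z * S z y :=
      Summable.of_norm_bounded (hterm y) fun z => by rw [Real.norm_eq_abs, abs_mul]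
    have h5 : ‖∑' z, T x z * S z y‖ ≤ ∑' z, ‖T x z * S z y‖ := norm_tsum_le_tsum_norm h4.norm
    simp only [Real.norm_eq_abs, abs_mul] at h5
    exact h5
  have hswap : Summable fun y => ∑' z, |T x z| * |S z y| := h2.prod_symm.prod
  have hsum : Summable fun y => |compKer T S x y| :=
    Summable.of_nonneg_of_le (fun _ => abs_nonneg _) hdom hswap
  refine ⟨hsum, ?_⟩
  have hz : Summable fun z => ∑' y, |T x z| * |S z y| := h2.prod
  calc ∑' y, |compKer T S x y| ≤ ∑' y, ∑' z, |T x z| * |S z y| := hsum.tsum_le_tsum hdom hswap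
    _ = ∑' z, ∑' y, |T x z| * |S z y| :=
        (show Summable (Function.uncurry fun z y => |T x z| * |S z y|) from h2).tsum_comm
    _ ≤ ∑' z, |T x z| * B₂ := hz.tsum_le_tsum hrow (hTx.mul_right B₂)
    _ = (∑' z, |T x z|) * B₂ := tsum_mul_right
    _ ≤ B₁ * B₂ := mul_le_mul_of_nonneg_right (hT x).2 hB₂

end Kernels

section Entry

variable {s : ℕ} [NeZero s]

/-- A linear map on the torus fields IS its matrix in the site basis: `A v a = Σ_b A(δ_b) a · v b`. [folklore] -/
private theorem apply_eq_sum_single (A : (TPt d s → ℝ) →ₗ[ℝ] (TPt d s → ℝ)) (v : TPt d s → ℝ) (a : TPt d s) :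
    A v a = ∑ b, A (Pi.single b 1) a * v b := by
  conv_lhs => rw [← Finset.univ_sum_single v]
  rw [map_sum, Finset.sum_apply]
  refine Finset.sum_congr rfl fun b _ => ?_
  have e : (Pi.single b (v b) : TPt d s → ℝ) = v b • (Pi.single b (1 : ℝ) : TPt d s → ℝ) := by
    rw [← Pi.single_smul', smul_eq_mul, mul_one]
  rw [e, map_smul, Pi.smul_apply, smul_eq_mul, mul_comm]

variable {K₁ K₂ : Kernel₂ d} {B₂ : ℝ}

/-- The entry shape is preserved by sums: `(A + B)(δ_b) a = (K₁ + K₂)^(a, b)` (the torus ↔ whole-lattice dictionary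
*"in the usual way"*, additive step). [cite: Balaban1984PropagatorsI, p.36] -/
theorem entry_add {A B : (TPt d s → ℝ) →ₗ[ℝ] (TPt d s → ℝ)}
    (hA : ∀ a b, A (Pi.single b 1) a = periodise₂ s K₁ a b) (hB : ∀ a b, B (Pi.single b 1) a = periodise₂ s K₂ a b)
    (h₁ : ∀ x, Summable (K₁ x)) (h₂ : ∀ x, Summable (K₂ x)) :
    ∀ a b, (A + B) (Pi.single b 1) a = periodise₂ s (K₁ + K₂) a b := fun a b => by
  rw [LinearMap.add_apply, Pi.add_apply, hA, hB, periodise₂_add h₁ h₂]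

/-- The entry shape is preserved by scalars (dictionary, homogeneous step). [cite: Balaban1984PropagatorsI, p.36] -/
theorem entry_smul {A : (TPt d s → ℝ) →ₗ[ℝ] (TPt d s → ℝ)} (hA : ∀ a b, A (Pi.single b 1) a = periodise₂ s K₁ a b)
    (c : ℝ) : ∀ a b, (c • A) (Pi.single b 1) a = periodise₂ s (fun x y => c * K₁ x y) a b := fun a b => by
  rw [LinearMap.smul_apply, Pi.smul_apply, smul_eq_mul, hA, periodise₂_const_mul]

/-- The entry shape is preserved by differences (dictionary, subtractive step — the shape of (182)'s minus sign).
[cite: Balaban1984PropagatorsI, p.36; Balaban1985Variational, (182) p.307] -/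
theorem entry_sub {A B : (TPt d s → ℝ) →ₗ[ℝ] (TPt d s → ℝ)}
    (hA : ∀ a b, A (Pi.single b 1) a = periodise₂ s K₁ a b) (hB : ∀ a b, B (Pi.single b 1) a = periodise₂ s K₂ a b)
    (h₁ : ∀ x, Summable (K₁ x)) (h₂ : ∀ x, Summable (K₂ x)) :
    ∀ a b, (A - B) (Pi.single b 1) a = periodise₂ s (K₁ + fun x y => (-1) * K₂ x y) a b := fun a b => by
  have hB' := entry_smul hB (-1 : ℝ)
  have h₂' : ∀ x, Summable fun y => (-1 : ℝ) * K₂ x y := fun x => (h₂ x).mul_left _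
  have e : A - B = A + (-1 : ℝ) • B := by rw [neg_one_smul ℝ B, sub_eq_add_neg]
  rw [e]
  exact entry_add hA hB' h₁ h₂' a b

/-- **The entry shape is preserved by COMPOSITION**: if `A(δ_b) a = K̂₁(a, b)` with absolutely summable rows of `K₁`
and `B(δ_b) a = K̂₂(a, b)` with `K₂` block-periodic and row-bounded, then `(A ∘ B)(δ_b) a = (K₁ ∘ K₂)^(a, b)` — the
product rule `periodise₂_compKer` read on linear maps. [cite: Balaban1984PropagatorsI, p.36; Slade2017, Lemma 2.2.2] -/
theorem entry_comp {A B : (TPt d s → ℝ) →ₗ[ℝ] (TPt d s → ℝ)}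
    (hA : ∀ a b, A (Pi.single b 1) a = periodise₂ s K₁ a b) (hB : ∀ a b, B (Pi.single b 1) a = periodise₂ s K₂ a b)
    (h₁ : ∀ x, Summable fun y => |K₁ x y|) (hK₂ : IsPeriodic₂ s K₂) (hK₂B : RowBound K₂ B₂) :
    ∀ a b, (A ∘ₗ B) (Pi.single b 1) a = periodise₂ s (compKer K₁ K₂) a b := fun a b => by
  rw [LinearMap.comp_apply, apply_eq_sum_single A, periodise₂_compKer h₁ hK₂ hK₂B]
  exact Finset.sum_congr rfl fun c _ => by rw [hB, hA, mul_comm]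

end Entry

/-! ## 2. The (182)-composite of periodised pieces is periodised -/

section Eq182

variable {s : ℕ} [NeZero s] {a₀ h₀ h 𝔡 : Kernel₂ d} {Ba Bh BH BD : ℝ}

/-- **δ𝐇∕δB = (𝔄₀ + H₀) − H𝔇(𝔄₀ + H₀) OF PERIODISED PIECES IS PERIODISED.**  If the Sect. G operators `𝔄₀`, `H₀`, `H`, `𝔇`
on the torus with `s` sites per direction act entrywise as the periodisations of block-periodic, row-bounded ℤ^d kernels
`a₀`, `h₀`, `h`, `𝔡`, and `dH` is given by (182), then `dH(δ_b) a = k̂₁₈₂(a, b)` for the ℤ^d kernel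
`k₁₈₂ := (a₀ + h₀) + (−1)·(h ∘ (𝔡 ∘ (a₀ + h₀)))`, which is block-periodic with row bound
`(Ba + Bh) + BH·(BD·(Ba + Bh))`. [cite: Balaban1985Variational, (182) p.307; Balaban1987RG1, (5.10) p.293] -/
theorem entry_eq182 {dH A0 H0 H Dfr : (TPt d s → ℝ) →ₗ[ℝ] (TPt d s → ℝ)} (h182 : Eq182 dH A0 H0 H Dfr)
    (hA0 : ∀ a b, A0 (Pi.single b 1) a = periodise₂ s a₀ a b) (hH0 : ∀ a b, H0 (Pi.single b 1) a = periodise₂ s h₀ a b)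
    (hH : ∀ a b, H (Pi.single b 1) a = periodise₂ s h a b) (hD : ∀ a b, Dfr (Pi.single b 1) a = periodise₂ s 𝔡 a b)
    (pa : IsPeriodic₂ s a₀) (ph₀ : IsPeriodic₂ s h₀) (ph : IsPeriodic₂ s h) (pd : IsPeriodic₂ s 𝔡)
    (ra : RowBound a₀ Ba) (rh₀ : RowBound h₀ Bh) (rh : RowBound h BH) (rd : RowBound 𝔡 BD) :
    (∀ a b, dH (Pi.single b 1) a =
        periodise₂ s ((a₀ + h₀) + fun x y => (-1) * compKer h (compKer 𝔡 (a₀ + h₀)) x y) a b) ∧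
      IsPeriodic₂ s ((a₀ + h₀) + fun x y => (-1) * compKer h (compKer 𝔡 (a₀ + h₀)) x y) ∧
      RowBound ((a₀ + h₀) + fun x y => (-1) * compKer h (compKer 𝔡 (a₀ + h₀)) x y)
        ((Ba + Bh) + |(-1 : ℝ)| * (BH * (BD * (Ba + Bh)))) := by
  have p1 : IsPeriodic₂ s (a₀ + h₀) := isPeriodic₂_add pa ph₀
  have r1 : RowBound (a₀ + h₀) (Ba + Bh) := rowBound_add ra rh₀
  have e1 : ∀ a b, (A0 + H0) (Pi.single b 1) a = periodise₂ s (a₀ + h₀) a b :=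
    entry_add hA0 hH0 ra.summable rh₀.summable
  have p2 : IsPeriodic₂ s (compKer 𝔡 (a₀ + h₀)) := isPeriodic₂_compKer pd p1
  have r2 : RowBound (compKer 𝔡 (a₀ + h₀)) (BD * (Ba + Bh)) := rowBound_compKer rd r1
  have e2 : ∀ a b, (Dfr ∘ₗ (A0 + H0)) (Pi.single b 1) a = periodise₂ s (compKer 𝔡 (a₀ + h₀)) a b :=
    entry_comp hD e1 rd.summable_abs p1 r1
  have p3 : IsPeriodic₂ s (compKer h (compKer 𝔡 (a₀ + h₀))) := isPeriodic₂_compKer ph p2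
  have r3 : RowBound (compKer h (compKer 𝔡 (a₀ + h₀))) (BH * (BD * (Ba + Bh))) := rowBound_compKer rh r2
  have e3 : ∀ a b, (H ∘ₗ (Dfr ∘ₗ (A0 + H0))) (Pi.single b 1) a =
      periodise₂ s (compKer h (compKer 𝔡 (a₀ + h₀))) a b := entry_comp hH e2 rh.summable_abs p2 r2
  refine ⟨fun a b => ?_, isPeriodic₂_add p1 (isPeriodic₂_smul p3 (-1)), rowBound_add r1 (rowBound_smul r3 (-1))⟩
  rw [h182]
  exact entry_sub e1 e3 r1.summable r3.summable a b

end Eq182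

/-! ## 3. The entry shape for a family over the tori IS NODE E's letter `hker` -/

section Hker

variable {M : ℕ} [NeZero M]

/-- **THE ENTRY SHAPE IS `hker`.**  If every member `dH n` of a kernel family over the tori with `N n·M` sites per
direction acts entrywise as the periodisation of ONE ℤ^d kernel `S`, then for every window `Y`, window sites `e Y` and
source site `x` the hypothesis `hker` of `RemainderDecay190SupNormLimit.hconv_restrictCLM_of_periodised` ∕
`RemainderDecay190SupNormLeaves.nonempty_polLeavesTFac190H_supNorm` holds with `S Y := S` — volume- and
window-independent. [cite: Balaban1987RG1, (5.10) p.293, (1.21) p.264] -/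
theorem hker_of_entry {N : ℕ → ℕ} [∀ n, NeZero (N n)]
    (dH : (n : ℕ) → (TPt d (N n * M) → ℝ) →ₗ[ℝ] (TPt d (N n * M) → ℝ)) {S : Kernel₂ d}
    (hent : ∀ n (a b : TPt d (N n * M)), dH n (Pi.single b 1) a = periodise₂ (N n * M) S a b)
    {LD : Type*} {ι : LD → Type*} (e : (Y : LD) → ι Y → Pt d) :
    ∀ (Y : LD) (n : ℕ) (i : ι Y) (x : Pt d),
      dH n (Pi.single (proj (N n * M) x) (1 : ℝ)) (proj (N n * M) (e Y i)) =
        periodise₂ (N n * M) S (proj (N n * M) (e Y i)) (proj (N n * M) x) :=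
  fun _ n _ _ => hent n _ _

end Hker

end Literature.MathematicalPhysics.QuantumFieldTheory.Balaban1983to89.Beta.RemainderKernelPeriodised
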